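import Summits.CriticalPhenomena.SAWScalingLimit.Theorems.SAWTotalPositivityCriticalBubbleBoundJoinSurgeryDefs
import Summits.CriticalPhenomena.SAWScalingLimit.Theorems.SAWTotalPositivityCriticalBubbleBoundJoinReflect
import Literature.Probability.RandomPlanarGeometry.SAWPolygonSurgery

/-!
# Frames of the Madras join: rotation about the window, translation, and the joining flip
(line `docking-census-joining`, helper of stub `joinPoly_spec`; registered helper stub `flipV_merge`)

Crux `stmt-CriticalPhenomena-7117`
(`Summit.CriticalPhenomena.SAWScalingLimit.Theses.SAWTotalPositivity.CriticalBubbleBound`), line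
`docking-census-joining` (lead c6, JOIN-MASS programme, wave 3). The join assembly `joinPoly_spec`
(Hammond, Ann. Probab. 46 (2018) = arXiv:1808.09032, §4.1, Definition 4.3, re-designed in
`…JoinSurgeryDefs`) treats the partner polygon THROUGH THE ROTATION by `π` about the window `Y`
(`rotY`, `rotE`), then TRANSLATES it by the spacer (`trE`), and finally JOINS the two modified
polygons by the plaquette flip `flipV`. This file supplies the elementary API of these three frames:

* `rotE`: membership (`mk_mem_rotE_iff`), vertices (`isV_rotE_iff`), involutivity (`rotE_rotE_eq`),
  cardinality (`card_rotE_eq`), polygons go to polygons (`isPolygon_rotE`, via the graph automorphism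
  `p ↦ 2Y - p` of `ℤ²` and `isPolygon_image_of_hom`);
* `trE`: the same list (`mk_mem_trE_iff`, `isV_trE_iff`, `card_trE_eq`, `isPolygon_trE`);
* `flipV_merge` — THE JOINING FLIP: if `E₁ ∋ {q, q+e₁}` and `E₂ ∋ {q+e₀, q+e₀+e₁}` are vertex-disjoint
  polygons (the left and right sides of the plaquette at `q`), then `flipV (E₁ ∪ E₂) q` (remove the two
  vertical sides, add the two horizontal ones) is a polygon with `#E₁ + #E₂` edges, the plaquette at `q`
  is a join plaquette of it, and the un-joining flip `flipH` gives `E₁ ∪ E₂` back — `IsPolygon.merge` of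
  `SAWPolygonSurgery.lean` with the two one-step connecting paths (the transpose of
  `Docking.exists_flip`).

Everything here is elementary ([folklore]).
-/

noncomputable section

open SimpleGraph
open Literature.Probability.LatticeModels
open Literature.Probability.RandomPlanarGeometry Literature.Probability.RandomPlanarGeometry.SAW
open scoped BigOperators
open Summit.CriticalPhenomena.SAWScalingLimit.Theorems.CriticalBubbleBound.Negative (e₀)
open Summit.CriticalPhenomena.SAWScalingLimit.Theorems.CriticalBubbleBound.Docking

namespace Summit.CriticalPhenomena.SAWScalingLimit.Theorems.CriticalBubbleBound.Join

/-! ## Rotation by `π` about a site -/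

/-- Coordinates of `rotY Y p = 2Y - p`. [folklore] -/
theorem rotY_apply (Y p : Site 2) (i : Fin 2) : rotY Y p i = Y i + Y i - p i := rfl

/-- `rotY Y` is injective (it is an involution). [folklore] -/
theorem rotY_injective (Y : Site 2) : Function.Injective (rotY Y) := fun p q h => by
  have h' := congrArg (rotY Y) h
  rwa [rotY_rotY, rotY_rotY] at h'

/-- `rotY Y p = -p + 2Y`. [folklore] -/
private theorem rotY_eq (Y p : Site 2) : rotY Y p = -p + (Y + Y) := by
  simp only [rotY]
  abel

/-- `rotY Y` preserves adjacency in `ℤ²`. [folklore] -/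
theorem adj_rotY (Y : Site 2) {a b : Site 2} (h : (zdGraph 2).Adj a b) :
    (zdGraph 2).Adj (rotY Y a) (rotY Y b) := by
  rw [rotY_eq, rotY_eq, Zd.zdGraph_adj_add_right, Zd.zdGraph_adj_neg]
  exact h

/-- `Sym2.map (rotY Y)` is an involution. [folklore] -/
private theorem map_rotY_map_rotY (Y : Site 2) (x : Sym2 (Site 2)) :
    Sym2.map (rotY Y) (Sym2.map (rotY Y) x) = x := by
  induction x using Sym2.ind with
  | _ a b => simp only [Sym2.map_mk, rotY_rotY]

/-- Membership in a rotated edge set: `e ∈ rotE Y E ↔ ρ(e) ∈ E`. [folklore] -/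
theorem mem_rotE_iff {Y : Site 2} {E : Finset (Sym2 (Site 2))} {e : Sym2 (Site 2)} :
    e ∈ rotE Y E ↔ Sym2.map (rotY Y) e ∈ E := by
  rw [rotE, Finset.mem_image]
  constructor
  · rintro ⟨e', he', rfl⟩
    rwa [map_rotY_map_rotY]
  · intro h
    exact ⟨_, h, map_rotY_map_rotY Y e⟩

/-- Membership of an explicit edge in a rotated edge set. [folklore] -/
theorem mk_mem_rotE_iff {Y : Site 2} {E : Finset (Sym2 (Site 2))} {a b : Site 2} :
    s(a, b) ∈ rotE Y E ↔ s(rotY Y a, rotY Y b) ∈ E := by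
  rw [mem_rotE_iff, Sym2.map_mk]

/-- Vertices of a rotated edge set: `p` is a vertex of `rotE Y E` iff `ρ p` is a vertex of `E`.
[folklore] -/
theorem isV_rotE_iff {Y : Site 2} {E : Finset (Sym2 (Site 2))} {p : Site 2} :
    IsV (rotE Y E) p ↔ IsV E (rotY Y p) := by
  constructor
  · rintro ⟨e, he, hp⟩
    exact ⟨_, mem_rotE_iff.1 he, Sym2.mem_map.2 ⟨p, hp, rfl⟩⟩
  · rintro ⟨e, he, hp⟩
    refine ⟨Sym2.map (rotY Y) e, mem_rotE_iff.2 (by rwa [map_rotY_map_rotY]), ?_⟩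
    exact Sym2.mem_map.2 ⟨rotY Y p, hp, rotY_rotY Y p⟩

/-- `rotE Y` is an involution. [folklore] -/
theorem rotE_rotE_eq (Y : Site 2) (E : Finset (Sym2 (Site 2))) : rotE Y (rotE Y E) = E := by
  ext e
  rw [mem_rotE_iff, mem_rotE_iff, map_rotY_map_rotY]

/-- Rotation preserves the number of edges. [folklore] -/
theorem card_rotE_eq (Y : Site 2) (E : Finset (Sym2 (Site 2))) : (rotE Y E).card = E.card :=
  Finset.card_image_of_injective _ (Sym2.map.injective (rotY_injective Y))

/-- The rotation of a polygon of `ℤ²` is a polygon. [folklore] -/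
theorem isPolygon_rotE (Y : Site 2) {E : Finset (Sym2 (Site 2))} (hE : IsPolygon (zdGraph 2) E) :
    IsPolygon (zdGraph 2) (rotE Y E) :=
  isPolygon_image_of_hom (f := ⟨rotY Y, fun h => adj_rotY Y h⟩) (rotY_injective Y) hE

/-! ## Translation -/

/-- `Sym2.map (· - v)` undoes `Sym2.map (· + v)`. [folklore] -/
private theorem map_sub_map_add (v : Site 2) (x : Sym2 (Site 2)) :
    Sym2.map (fun p => p - v) (Sym2.map (fun p => p + v) x) = x := by
  induction x using Sym2.ind with
  | _ a b => simp only [Sym2.map_mk, add_sub_cancel_right]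

/-- `Sym2.map (· + v)` undoes `Sym2.map (· - v)`. [folklore] -/
private theorem map_add_map_sub (v : Site 2) (x : Sym2 (Site 2)) :
    Sym2.map (fun p => p + v) (Sym2.map (fun p => p - v) x) = x := by
  induction x using Sym2.ind with
  | _ a b => simp only [Sym2.map_mk, sub_add_cancel]

/-- Membership in a translated edge set: `e ∈ trE v E ↔ e - v ∈ E`. [folklore] -/
theorem mem_trE_iff {v : Site 2} {E : Finset (Sym2 (Site 2))} {e : Sym2 (Site 2)} :
    e ∈ trE v E ↔ Sym2.map (fun p => p - v) e ∈ E := by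
  rw [mem_trE]
  constructor
  · rintro ⟨e', he', rfl⟩
    rwa [map_sub_map_add]
  · intro h
    exact ⟨_, h, map_add_map_sub v e⟩

/-- Membership of an explicit edge in a translated edge set. [folklore] -/
theorem mk_mem_trE_iff {v : Site 2} {E : Finset (Sym2 (Site 2))} {a b : Site 2} :
    s(a, b) ∈ trE v E ↔ s(a - v, b - v) ∈ E := by
  rw [mem_trE_iff, Sym2.map_mk]

/-- Vertices of a translated edge set: `p` is a vertex of `trE v E` iff `p - v` is a vertex of `E`.
[folklore] -/
theorem isV_trE_iff {v : Site 2} {E : Finset (Sym2 (Site 2))} {p : Site 2} :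
    IsV (trE v E) p ↔ IsV E (p - v) := by
  constructor
  · rintro ⟨e, he, hp⟩
    exact ⟨_, mem_trE_iff.1 he, Sym2.mem_map.2 ⟨p, hp, rfl⟩⟩
  · rintro ⟨e, he, hp⟩
    refine ⟨Sym2.map (fun p => p + v) e, mem_trE.2 ⟨e, he, rfl⟩, ?_⟩
    exact Sym2.mem_map.2 ⟨p - v, hp, sub_add_cancel p v⟩

/-- Translation preserves the number of edges. [folklore] -/
theorem card_trE_eq (v : Site 2) (E : Finset (Sym2 (Site 2))) : (trE v E).card = E.card :=
  Finset.card_image_of_injective _ (Sym2.map.injective (add_left_injective v))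

/-- The translate of a polygon of `ℤ²` is a polygon. [folklore] -/
theorem isPolygon_trE (v : Site 2) {E : Finset (Sym2 (Site 2))} (hE : IsPolygon (zdGraph 2) E) :
    IsPolygon (zdGraph 2) (trE v E) :=
  isPolygon_image_of_hom (f := ⟨fun p => p + v, fun h => (Zd.zdGraph_adj_add_right _ _ v).2 h⟩)
    (add_left_injective v) hE

/-! ## The joining flip -/

/-- **The joining flip.** Let `E₁ ∋ {q, q+e₁}` and `E₂ ∋ {q+e₀, q+e₀+e₁}` be vertex-disjoint polygons
of `ℤ²` (the left and right sides of the unit square at `q`). Then `flipV (E₁ ∪ E₂) q` — remove these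
two vertical sides, add the two horizontal ones — is a polygon with `#E₁ + #E₂` edges, the square at `q`
is a join plaquette of it, and the un-joining flip `flipH` at `q` gives `E₁ ∪ E₂` back.
[cite: Hammond2015SAPJoining, Definition 2.3 (the joining of two polygons across a plaquette)] -/
theorem flipV_merge : ∀ (E₁ E₂ : Finset (Sym2 (Site 2))) (q : Site 2), IsPolygon (zdGraph 2) E₁ → IsPolygon (zdGraph 2) E₂ → (∀ x : Site 2, IsV E₁ x → IsV E₂ x → False) → s(q, q + e₁) ∈ E₁ → s(q + e₀, q + e₀ + e₁) ∈ E₂ → IsPolygon (zdGraph 2) (flipV (E₁ ∪ E₂) q) ∧ (flipV (E₁ ∪ E₂) q).card = E₁.card + E₂.card ∧ IsJoinPlaq (flipV (E₁ ∪ E₂) q) q ∧ flipH (flipV (E₁ ∪ E₂) q) q = E₁ ∪ E₂ := by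
  intro E₁ E₂ q h₁ h₂ hdis hlf hrt
  obtain ⟨c1, c2, c3, c4, c5, c6⟩ := corners_ne q
  -- the four corners: `q`, `q + e₁` on `E₁`, `q + e₀`, `q + e₀ + e₁` on `E₂`
  have hq : IsV E₁ q := ⟨_, hlf, Sym2.mem_mk_left _ _⟩
  have hq₁ : IsV E₁ (q + e₁) := ⟨_, hlf, Sym2.mem_mk_right _ _⟩
  have hq₀ : IsV E₂ (q + e₀) := ⟨_, hrt, Sym2.mem_mk_left _ _⟩
  have hq₀₁ : IsV E₂ (q + e₀ + e₁) := ⟨_, hrt, Sym2.mem_mk_right _ _⟩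
  have hlf₂ : s(q, q + e₁) ∉ E₂ := fun h => hdis q hq ⟨_, h, Sym2.mem_mk_left _ _⟩
  have hrt₁ : s(q + e₀, q + e₀ + e₁) ∉ E₁ := fun h => hdis _ ⟨_, h, Sym2.mem_mk_left _ _⟩ hq₀
  have hlo₁ : s(q, q + e₀) ∉ E₁ := fun h => hdis _ ⟨_, h, Sym2.mem_mk_right _ _⟩ hq₀
  have hlo₂ : s(q, q + e₀) ∉ E₂ := fun h => hdis q hq ⟨_, h, Sym2.mem_mk_left _ _⟩
  have hhi₁ : s(q + e₁, q + e₀ + e₁) ∉ E₁ := fun h => hdis _ ⟨_, h, Sym2.mem_mk_right _ _⟩ hq₀₁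
  have hhi₂ : s(q + e₁, q + e₀ + e₁) ∉ E₂ := fun h => hdis _ hq₁ ⟨_, h, Sym2.mem_mk_left _ _⟩
  -- the two horizontal sides as one-edge paths and the merge
  have hadj : (zdGraph 2).Adj (q + e₁) (q + e₀ + e₁) := by
    have h := adj_add_e₀ (q + e₁)
    rwa [add_right_comm] at h
  let R₁ : (zdGraph 2).Walk q (q + e₀) := (adj_add_e₀ q).toWalk
  let R₂ : (zdGraph 2).Walk (q + e₁) (q + e₀ + e₁) := hadj.toWalk
  have hR₁s : ∀ x ∈ R₁.support, x = q ∨ x = q + e₀ := fun x hx => by simpa [R₁] using hx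
  have hR₂s : ∀ x ∈ R₂.support, x = q + e₁ ∨ x = q + e₀ + e₁ := fun x hx => by simpa [R₂] using hx
  have hm := h₁.merge h₂ hlf hrt (R₁ := R₁) (R₂ := R₂) (Walk.IsPath.of_adj _) (Walk.IsPath.of_adj _)
    hdis
    (fun x hx h => by
      rcases hR₁s x hx with rfl | rfl
      · rfl
      · exact (hdis _ h hq₀).elim)
    (fun x hx h => by
      rcases hR₁s x hx with rfl | rfl
      · exact (hdis _ hq h).elim
      · rfl)
    (fun x hx h => by
      rcases hR₂s x hx with rfl | rfl
      · rfl
      · exact (hdis _ h hq₀₁).elim)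
    (fun x hx h => by
      rcases hR₂s x hx with rfl | rfl
      · exact (hdis _ hq₁ h).elim
      · rfl)
    (fun x hx hx' => by
      rcases hR₁s x hx with rfl | rfl <;> rcases hR₂s _ hx' with h | h
      · exact c2 h.symm
      · exact c3 h.symm
      · exact c4 h
      · exact c5 h.symm)
  have hR₁e : R₁.edges.toFinset = {s(q, q + e₀)} := by simp [R₁]
  have hR₂e : R₂.edges.toFinset = {s(q + e₁, q + e₀ + e₁)} := by simp [R₂]
  have hR₁l : R₁.length = 1 := by simp [R₁]
  have hR₂l : R₂.length = 1 := by simp [R₂]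
  rw [hR₁e, hR₂e, hR₁l, hR₂l] at hm
  -- the merged edge set is the flipped set
  have hMC : E₁.erase s(q, q + e₁) ∪ E₂.erase s(q + e₀, q + e₀ + e₁) ∪
      ({s(q, q + e₀)} ∪ {s(q + e₁, q + e₀ + e₁)}) = flipV (E₁ ∪ E₂) q := by
    ext e
    simp only [flipV, Finset.mem_union, Finset.mem_erase, Finset.mem_insert, Finset.mem_singleton]
    have k1 : e ∈ E₁ → e ≠ s(q + e₀, q + e₀ + e₁) := fun h h' => hrt₁ (h' ▸ h)
    have k2 : e ∈ E₂ → e ≠ s(q, q + e₁) := fun h h' => hlf₂ (h' ▸ h)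
    tauto
  rw [hMC] at hm
  refine ⟨hm.1, by omega, ⟨Finset.mem_insert_self _ _,
    Finset.mem_insert_of_mem (Finset.mem_insert_self _ _), ?_, ?_⟩, ?_⟩
  · simp only [flipV, Finset.mem_insert, Finset.mem_erase, not_or]
    exact ⟨(lo_ne_left q).symm, (hi_ne_left q).symm, fun h => h.2.1 rfl⟩
  · simp only [flipV, Finset.mem_insert, Finset.mem_erase, not_or]
    exact ⟨(lo_ne_right q).symm, (hi_ne_right q).symm, fun h => h.1 rfl⟩
  · have hl : s(q, q + e₀) ∉ insert s(q + e₁, q + e₀ + e₁)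
        (((E₁ ∪ E₂).erase s(q, q + e₁)).erase s(q + e₀, q + e₀ + e₁)) := by
      simp only [Finset.mem_insert, Finset.mem_erase, Finset.mem_union, not_or]
      exact ⟨(hi_ne_lo q).symm, fun h => h.2.2.elim hlo₁ hlo₂⟩
    have hr : s(q + e₁, q + e₀ + e₁) ∉
        ((E₁ ∪ E₂).erase s(q, q + e₁)).erase s(q + e₀, q + e₀ + e₁) := by
      simp only [Finset.mem_erase, Finset.mem_union, not_and, not_or]
      exact fun _ _ => ⟨hhi₁, hhi₂⟩
    rw [flipH, flipV, Finset.erase_insert hl, Finset.erase_insert hr]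
    have hrt' : s(q + e₀, q + e₀ + e₁) ∈ (E₁ ∪ E₂).erase s(q, q + e₁) :=
      Finset.mem_erase.2 ⟨(left_ne_right q).symm, Finset.mem_union_right _ hrt⟩
    rw [Finset.insert_erase hrt', Finset.insert_erase (Finset.mem_union_left _ hlf)]

end Summit.CriticalPhenomena.SAWScalingLimit.Theorems.CriticalBubbleBound.Join

end
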